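import Literature.InformationTheory.QuantumCodes.DistanceFailureFloorPhenomenological
import Literature.InformationTheory.QuantumCodes.SpherePackingThreshold
import HarnessLib

/-!
# "Recovery is more difficult with imperfect syndrome information than with perfect syndrome information":
# `P^{opt}_p ≤ P^{ph}_{p,q}[D]` for every space-time decoder, hence `p_c^{ph} ≤ p_c^{opt}` and the hashing ceiling
# `h₂(p_c^{ph}) ≤ 1 − R` for phenomenological noise

Topic `Literature/InformationTheory/QuantumCodes` (venture QEC, LADDER-QEC rung Q5; qec-lit-2 gen 6). Theorem-only;
no definition, no named fact, no `sorry`.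

**Printed statement.** Dennis–Kitaev–Landahl–Preskill 2002, §4.2 (end): "Since recovery is more difficult with
imperfect syndrome information than with perfect syndrome information, the numerical data on the random-bond Ising
model indicate that `p_c < .11` for any `q > 0`." The printed NUMBER `.11` is the RBIM / hashing-type estimate of the
optimal code-capacity threshold of the toric code (a VALIDATED value); what is proved here is the COMPARISON, for every
CSS code and every space-time decoder, and its consequences for positive-rate families, where the tree's certified
code-capacity ceilings for the OPTIMAL decoder (the hashing bound of `SpherePackingThreshold.lean`) become ceilings for
phenomenological noise at every measurement rate `q`:

* `CSSCode.zOptimalFailure_le_phenomFailureProb` / `xOptimalFailure_le_phenomFailureProb` — for every CSS code,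
  `T ≥ 1` rounds (`t₀ : Fin T`), EVERY space-time decoder `D`, `0 ≤ p ≤ 1`, `0 ≤ q ≤ 1`:
  `zOptimalFailure C p ≤ P^{ph,Z}_{p,q}[D fails]` (mixture principle
  `CSSPhenom.le_phenomFailureProb_of_forall_decoder` + optimality of maximum-likelihood decoding
  `CSSCode.zOptimalFailure_le`);
* families (`T_i ≥ 1`, any schedule `q_i ∈ [0,1]`, ANY space-time decoder family): a phenomenological
  below-threshold rate is a code-capacity below-threshold rate of the optimal family
  (`optimal_belowThreshold_of_phenom_belowThreshold`), so
  `accuracyThreshold (PH family) ≤ accuracyThreshold (i ↦ zOptimalFailure (C i))`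
  (`phenom_accuracyThreshold_le_optimal_codeCapacity`; `X` twin);
* **the phenomenological hashing ceiling** (`phenom_accuracyThreshold_le_of_rate`): for every CSS family with
  `n_i → ∞` and `R·n_i ≤ k_i`, every space-time decoder family and every `q`-schedule, no `0 < p ≤ 1/2` with
  `h(p) > (1 − R) log 2` is below threshold, and `p_c^{ph,Z} ≤ p` (so `h₂(p_c^{ph}) ≤ 1 − R`; `R > 0 ⇒ p_c^{ph} < 1/2`).

Not claimed: the value `.11` or any number for a specific family; `q`-dependence of `p_c^{ph}`; circuit-level noise.

## References

* [DennisEtAl2002] E. Dennis, A. Kitaev, A. Landahl, J. Preskill, J. Math. Phys. 43 (2002) 4452 =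
  arXiv:quant-ph/0110143, §4.2 end (chunk p0018 L1: "recovery is more difficult with imperfect syndrome information
  … p_c < .11 for any q > 0"), §4.3, §4.6–4.7, §5.2 (Prob_fail).
* [RichardsonUrbanke2008] T. Richardson, R. Urbanke, *Modern Coding Theory*, §1.6 (converse: P_B → 1 above capacity),
  Lemma 4.78.
* [BravyiSucharaVargo2014] S. Bravyi, M. Suchara, A. Vargo, Phys. Rev. A 90 (2014) 032326, §1 (MLD is optimal).
-/

namespace Literature.InformationTheory.QuantumCodes

open Finset Matrix Filter Topology CSSPhenom

/-! ### One code: perfect syndrome information is never worse -/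

namespace CSSCode

variable {RX RZ V : Type*} [Fintype V] [DecidableEq V] [Fintype RX] [DecidableEq RX] [Fintype RZ] [DecidableEq RZ]
  {T : ℕ}

omit [DecidableEq RZ] in
/-- **`P^{Z,opt}_p ≤ P^{ph,Z}_{p,q}[D]`**: for every CSS code, `T ≥ 1` rounds, EVERY space-time decoder `D` of the
noisy `X`-syndrome record, `0 ≤ p ≤ 1` and `0 ≤ q ≤ 1`, the optimal code-capacity `Z`-failure probability at rate `p`
is at most the phenomenological failure probability ("recovery is more difficult with imperfect syndrome information
than with perfect syndrome information"). [cite: DennisEtAl2002, §4.2 (chunk p0018 L1) and §4.3, §5.2; BravyiSucharaVargo2014, §1] -/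
theorem zOptimalFailure_le_phenomFailureProb (C : CSSCode RX RZ V) (D : STDecoder RX V T) (t₀ : Fin T) {p q : ℝ}
    (hp0 : 0 ≤ p) (hp1 : p ≤ 1) (hq0 : 0 ≤ q) (hq1 : q ≤ 1) :
    C.zOptimalFailure p ≤ phenomFailureProb C.HX T (C.rowSpZ : Set (V → ZMod 2)) D p q :=
  le_phenomFailureProb_of_forall_decoder C.HX C.rowSpZ D t₀ hp0 hp1 hq0 hq1 fun D' => C.zOptimalFailure_le D' p

omit [DecidableEq RX] in
/-- **`P^{X,opt}_p ≤ P^{ph,X}_{p,q}[D]`** (`X`-sector: noisy `Z`-syndrome record, bit flips).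
[cite: DennisEtAl2002, §4.2 (chunk p0018 L1) and §4.3, §5.2; BravyiSucharaVargo2014, §1] -/
theorem xOptimalFailure_le_phenomFailureProb (C : CSSCode RX RZ V) (D : STDecoder RZ V T) (t₀ : Fin T) {p q : ℝ}
    (hp0 : 0 ≤ p) (hp1 : p ≤ 1) (hq0 : 0 ≤ q) (hq1 : q ≤ 1) :
    C.xOptimalFailure p ≤ phenomFailureProb C.HZ T (C.rowSpX : Set (V → ZMod 2)) D p q :=
  le_phenomFailureProb_of_forall_decoder C.HZ C.rowSpX D t₀ hp0 hp1 hq0 hq1 fun D' => C.xOptimalFailure_le D' p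

end CSSCode

/-! ### Families: phenomenological thresholds are at most optimal code-capacity thresholds -/

section Families

/-- Transfer of accuracy thresholds along an implication of below-threshold predicates on `[0, 1)`.
[cite: DennisEtAl2002, §4.7 (a lower bound on p_c)] -/
theorem accuracyThreshold_le_of_belowThreshold_imp {P P' : ℕ → ℝ → ℝ}
    (h : ∀ p : ℝ, 0 ≤ p → p < 1 → BelowThreshold P p → BelowThreshold P' p) :
    accuracyThreshold P ≤ accuracyThreshold P' :=
  le_accuracyThreshold
    (fun p hp0 hpa => h p hp0 (lt_of_lt_of_le hpa (accuracyThreshold_le_one P))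
      (belowThreshold_of_lt_accuracyThreshold hp0 hpa))
    (accuracyThreshold_le_one P)

variable {RX RZ Q : ℕ → Type*} [∀ i, Fintype (Q i)] [∀ i, DecidableEq (Q i)] [∀ i, Fintype (RX i)]
  [∀ i, DecidableEq (RX i)] [∀ i, Fintype (RZ i)] [∀ i, DecidableEq (RZ i)]

omit [∀ i, DecidableEq (RZ i)] in
/-- **A phenomenological below-threshold rate is a code-capacity below-threshold rate of the optimal decoder**
(`Z`-sector; `T_i ≥ 1`, any schedule `q_i ∈ [0,1]`, any space-time decoder family; `0 ≤ p ≤ 1`).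
[cite: DennisEtAl2002, §4.2 (chunk p0018 L1), §4.3 (below threshold)] -/
theorem optimal_belowThreshold_of_phenom_belowThreshold (C : ∀ i, CSSCode (RX i) (RZ i) (Q i)) (T : ℕ → ℕ)
    (hT : ∀ i, 0 < T i) (DZ : ∀ i, STDecoder (RX i) (Q i) (T i)) (q : ℕ → ℝ) (hq0 : ∀ i, 0 ≤ q i)
    (hq1 : ∀ i, q i ≤ 1) {p : ℝ} (hp0 : 0 ≤ p) (hp1 : p ≤ 1)
    (h : BelowThreshold
      (fun i p => phenomFailureProb (C i).HX (T i) ((C i).rowSpZ : Set (Q i → ZMod 2)) (DZ i) p (q i)) p) :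
    BelowThreshold (fun i p => (C i).zOptimalFailure p) p :=
  h.of_le (fun i => (C i).zOptimalFailure_nonneg hp0 hp1)
    fun i => (C i).zOptimalFailure_le_phenomFailureProb (DZ i) ⟨0, hT i⟩ hp0 hp1 (hq0 i) (hq1 i)

omit [∀ i, DecidableEq (RX i)] in
/-- The `X`-sector twin: a phenomenological below-threshold rate of the noisy `Z`-syndrome record is a code-capacity
below-threshold rate of the optimal `X`-decoder. [cite: DennisEtAl2002, §4.2 (chunk p0018 L1), §4.3] -/
theorem xOptimal_belowThreshold_of_phenom_belowThreshold (C : ∀ i, CSSCode (RX i) (RZ i) (Q i)) (T : ℕ → ℕ)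
    (hT : ∀ i, 0 < T i) (DX : ∀ i, STDecoder (RZ i) (Q i) (T i)) (q : ℕ → ℝ) (hq0 : ∀ i, 0 ≤ q i)
    (hq1 : ∀ i, q i ≤ 1) {p : ℝ} (hp0 : 0 ≤ p) (hp1 : p ≤ 1)
    (h : BelowThreshold
      (fun i p => phenomFailureProb (C i).HZ (T i) ((C i).rowSpX : Set (Q i → ZMod 2)) (DX i) p (q i)) p) :
    BelowThreshold (fun i p => (C i).xOptimalFailure p) p :=
  h.of_le (fun i => (C i).xOptimalFailure_nonneg hp0 hp1)
    fun i => (C i).xOptimalFailure_le_phenomFailureProb (DX i) ⟨0, hT i⟩ hp0 hp1 (hq0 i) (hq1 i)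

omit [∀ i, DecidableEq (RZ i)] in
/-- **`p_c^{ph,Z} ≤ p_c^{Z,opt}`**: the phenomenological accuracy threshold of EVERY space-time decoder family (any
`T_i ≥ 1`, any `q`-schedule in `[0,1]`) is at most the code-capacity accuracy threshold of the optimal decoder.
[cite: DennisEtAl2002, §4.2 (chunk p0018 L1: "recovery is more difficult with imperfect syndrome information … p_c < .11 for any q > 0"), §4.6–4.7] -/
theorem phenom_accuracyThreshold_le_optimal_codeCapacity (C : ∀ i, CSSCode (RX i) (RZ i) (Q i)) (T : ℕ → ℕ)
    (hT : ∀ i, 0 < T i) (DZ : ∀ i, STDecoder (RX i) (Q i) (T i)) (q : ℕ → ℝ) (hq0 : ∀ i, 0 ≤ q i)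
    (hq1 : ∀ i, q i ≤ 1) :
    accuracyThreshold
        (fun i p => phenomFailureProb (C i).HX (T i) ((C i).rowSpZ : Set (Q i → ZMod 2)) (DZ i) p (q i)) ≤
      accuracyThreshold (fun i p => (C i).zOptimalFailure p) :=
  accuracyThreshold_le_of_belowThreshold_imp fun _ hp0 hp1 h =>
    optimal_belowThreshold_of_phenom_belowThreshold C T hT DZ q hq0 hq1 hp0 hp1.le h

omit [∀ i, DecidableEq (RX i)] in
/-- **`p_c^{ph,X} ≤ p_c^{X,opt}`** (`X`-sector twin). [cite: DennisEtAl2002, §4.2 (chunk p0018 L1), §4.6–4.7] -/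
theorem x_phenom_accuracyThreshold_le_optimal_codeCapacity (C : ∀ i, CSSCode (RX i) (RZ i) (Q i)) (T : ℕ → ℕ)
    (hT : ∀ i, 0 < T i) (DX : ∀ i, STDecoder (RZ i) (Q i) (T i)) (q : ℕ → ℝ) (hq0 : ∀ i, 0 ≤ q i)
    (hq1 : ∀ i, q i ≤ 1) :
    accuracyThreshold
        (fun i p => phenomFailureProb (C i).HZ (T i) ((C i).rowSpX : Set (Q i → ZMod 2)) (DX i) p (q i)) ≤
      accuracyThreshold (fun i p => (C i).xOptimalFailure p) :=
  accuracyThreshold_le_of_belowThreshold_imp fun _ hp0 hp1 h =>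
    xOptimal_belowThreshold_of_phenom_belowThreshold C T hT DX q hq0 hq1 hp0 hp1.le h

omit [∀ i, DecidableEq (RZ i)] in
/-- **THE PHENOMENOLOGICAL HASHING CEILING (`Z`-sector).** For every CSS family with `n_i → ∞` and rate `≥ R`
(`R·n_i ≤ k_i`), rounds `T_i ≥ 1`, any `q`-schedule in `[0,1]` and ANY space-time decoder family: no qubit rate
`0 < p ≤ 1/2` with `h(p) > (1 − R) log 2` is below threshold, and `p_c^{ph,Z} ≤ p` (hence `h₂(p_c^{ph,Z}) ≤ 1 − R`).
[cite: DennisEtAl2002, §4.2 (chunk p0018 L1) and §4.6 (p_c); RichardsonUrbanke2008, §1.6 (converse above capacity)] -/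
theorem phenom_accuracyThreshold_le_of_rate (C : ∀ i, CSSCode (RX i) (RZ i) (Q i)) (T : ℕ → ℕ) (hT : ∀ i, 0 < T i)
    (DZ : ∀ i, STDecoder (RX i) (Q i) (T i)) (q : ℕ → ℝ) (hq0 : ∀ i, 0 ≤ q i) (hq1 : ∀ i, q i ≤ 1) {p R : ℝ}
    (hp0 : 0 < p) (hp : p ≤ 1 / 2) (hn : Tendsto (fun i => Fintype.card (Q i)) atTop atTop)
    (hR : ∀ i, R * Fintype.card (Q i) ≤ (C i).k) (hcap : (1 - R) * Real.log 2 < Real.binEntropy p) :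
    ¬ BelowThreshold
        (fun i p => phenomFailureProb (C i).HX (T i) ((C i).rowSpZ : Set (Q i → ZMod 2)) (DZ i) p (q i)) p ∧
      accuracyThreshold
        (fun i p => phenomFailureProb (C i).HX (T i) ((C i).rowSpZ : Set (Q i → ZMod 2)) (DZ i) p (q i)) ≤ p := by
  have hopt := CSSCode.optimal_accuracyThreshold_le_of_rate C hp0 hp hn hR hcap
  refine ⟨fun h => hopt.1 (optimal_belowThreshold_of_phenom_belowThreshold C T hT DZ q hq0 hq1 hp0.le
    (by linarith) h), ?_⟩
  exact (phenom_accuracyThreshold_le_optimal_codeCapacity C T hT DZ q hq0 hq1).trans hopt.2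

omit [∀ i, DecidableEq (RX i)] in
/-- **The phenomenological hashing ceiling, `X`-sector.** [cite: DennisEtAl2002, §4.2 (chunk p0018 L1) and §4.6; RichardsonUrbanke2008, §1.6] -/
theorem x_phenom_accuracyThreshold_le_of_rate (C : ∀ i, CSSCode (RX i) (RZ i) (Q i)) (T : ℕ → ℕ)
    (hT : ∀ i, 0 < T i) (DX : ∀ i, STDecoder (RZ i) (Q i) (T i)) (q : ℕ → ℝ) (hq0 : ∀ i, 0 ≤ q i)
    (hq1 : ∀ i, q i ≤ 1) {p R : ℝ} (hp0 : 0 < p) (hp : p ≤ 1 / 2)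
    (hn : Tendsto (fun i => Fintype.card (Q i)) atTop atTop) (hR : ∀ i, R * Fintype.card (Q i) ≤ (C i).k)
    (hcap : (1 - R) * Real.log 2 < Real.binEntropy p) :
    ¬ BelowThreshold
        (fun i p => phenomFailureProb (C i).HZ (T i) ((C i).rowSpX : Set (Q i → ZMod 2)) (DX i) p (q i)) p ∧
      accuracyThreshold
        (fun i p => phenomFailureProb (C i).HZ (T i) ((C i).rowSpX : Set (Q i → ZMod 2)) (DX i) p (q i)) ≤ p := by
  have hopt := CSSCode.optimal_accuracyThreshold_le_of_rate (fun i => (C i).swap) hp0 hp hn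
    (fun i => by rw [CSSCode.k_swap]; exact hR i) hcap
  have himp : ∀ p' : ℝ, 0 ≤ p' → p' ≤ 1 →
      BelowThreshold
        (fun i p => phenomFailureProb (C i).HZ (T i) ((C i).rowSpX : Set (Q i → ZMod 2)) (DX i) p (q i)) p' →
      BelowThreshold (fun i p => (C i).swap.zOptimalFailure p) p' := fun p' hp'0 hp'1 h =>
    xOptimal_belowThreshold_of_phenom_belowThreshold C T hT DX q hq0 hq1 hp'0 hp'1 h
  refine ⟨fun h => hopt.1 (himp p hp0.le (by linarith) h), ?_⟩
  exact (accuracyThreshold_le_of_belowThreshold_imp fun p' hp'0 hp'1 h => himp p' hp'0 hp'1.le h).trans hopt.2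

end Families

end Literature.InformationTheory.QuantumCodes
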